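import Summits.CriticalPhenomena.PercolationContinuityZ3.Theorems.PercNearOneGluingNoHeavyLowerTailSahiHubTwoLevelTypeFlow
import Summits.CriticalPhenomena.PercolationContinuityZ3.Theorems.PercNearOneGluingNoHeavyLowerTailSahiHubTwoLevelCrossForm
import Mathlib.Tactic.Linarith
import Mathlib.Tactic.Positivity
import Mathlib.Tactic.Ring
import HarnessLib

/-!
# `NoHeavyLowerTail` (crux stmt-CriticalPhenomena-4575), P2 — THE ONE-LEVEL ("INDEPENDENT TOPS") LAW ON ABSTRACT FKG BLOCKS, BY AN EXPLICIT
# h-FREE CERTIFICATE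

Seat `prim-masterthm-p2`, gen 28 (memo `FROM-prim-masterthm-p2-g28-H-FREE-FLOW.md` §8; `--supports stmt-CriticalPhenomena-4575`).
No `sorry`, no named facts, standard axioms.

SETTING (`…SahiHubTwoLevel`, one hub level `z` at a time): FKG probability weights `wA, wB` on finite distributive lattices `α, β`; at level
`z`, nested sections `0 ≤ f 0 z ≤ f 1 z ≤ 1` on `α` and `0 ≤ g 0 z ≤ g 1 z ≤ 1` on `β` (monotone), and `h z : α → β → ℝ≥0` monotone in each
argument; level means `A_i = Fm wA f i z`, `B_j = gm wB g j z`.  The ONE-LEVEL FORM (tree `levelForm wA wB f g h z z` of `…CrossForm`) is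
  `L = 2E[f₀g₀h] + 2E[f₁g₁h] − A₀E[g₁h] − A₁E[g₀h] − B₀E[f₁h] − B₁E[f₀h] − (A₁−A₀)(B₁−B₀)E[h]`   (product weight `wA ⊗ wB`).

* `levelKernel z z'`, `levelForm_eq_kernel` — kernel form `L(z;z') = Σ_b wB Σ_a wA h·K(z;z')`; `K₁ := K(z;z) = 2f₀g₀ + 2f₁g₁ − A₀g₁ − A₁g₀ − B₀f₁ − B₁f₀ − (A₁−A₀)(B₁−B₀)`.
* `levelKernel_certificate` — **THE EXPLICIT CERTIFICATE** (a polynomial identity; found by LP + symbolic solve, this session):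
  `A₁B₁·K₁ = Λ(b)·(f₁(a)−A₁) + A₁B₀g₀(b)·(f₀(a)−A₀) + M(a)·(g₁(b)−B₁) + B₁A₀f₀(a)·(g₀(b)−B₀) + (A₁B₁−A₀B₀)(f₁−f₀)(a)(g₁−g₀)(b) + SU·f₀(a)g₀(b)`,
  `Λ = SUB₁·(1−g₁) + (A₀(1−U)+A₁U)B₁·(g₁−g₀) + (A₀U(1−B₁)+A₁B₁(1+U))·g₀ ≥ 0`, `M = (A₁B₁−A₀U)(f₁−f₀) + (2A₁−A₀)B₁f₀ ≥ 0`, `S = A₁−A₀`, `U = B₁−B₀`.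
  Every term integrates against `h` to something nonnegative: the first four by FKG on a FIBRE (`a ↦ h(a,b)` against `f_i`, resp.
  `b ↦ h(a,b)` against `g_j`; lemmas `harrisA_nonneg`, `harrisB_nonneg` of `…TypeFlow`), the last two pointwise.
* **`levelForm_self_nonneg` — THE ONE-LEVEL LAW: `L ≥ 0`.**  (Degenerate levels `A₁ = 0` or `B₁ = 0` give `L = 0`.)
* **`twoLevel_nonneg_of_crossForm_nonneg'`** — consequently the reduction of `…CrossForm` needs ONLY the bias-free inequality:
  `crossForm ≥ 0 ⟹ twoLevel ≥ 0` at every hub bias (then `C₃` on T₁(|C|=1) via `sahiE_three_nonneg_T1C1_of_twoLevel_nonneg`).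
This is bnk-2's "independent tops" law (`…SahiTwoLevelIndependentTops`, product Bernoulli cubes) for arbitrary FKG lattice blocks, with a
certificate that uses fibre-Harris only.  HONEST LABEL: one-level law PROVED here; `crossForm ≥ 0` (I3), T₁(|C|=1), `C₃` OPEN. [this work]
-/

noncomputable section

open scoped Classical

namespace Summit.CriticalPhenomena.PercolationContinuityZ3.Theorems

namespace SahiHubTwoLevel

open Finset Literature.Combinatorics.Sahi2008

section Kernel

variable {α β : Type} [Fintype α] [Fintype β]
  (wA : α → ℝ) (wB : β → ℝ) (f : Fin 2 → Fin 2 → α → ℝ) (g : Fin 2 → Fin 2 → β → ℝ)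

/-- The level kernel `K(z;z')(a,b) = 2f₀g₀ + 2f₁g₁ − F₀(z')g₁ − F₁(z')g₀ − G₀(z')f₁ − G₁(z')f₀ − (F₁−F₀)(z')(G₁−G₀)(z')`: level-`z` sections,
level-`z'` constants (`z' = z`: the one-level kernel; `z' ≠ z`: the crossed kernels of `crossForm`). [this work] -/
def levelKernel (z z' : Fin 2) (a : α) (b : β) : ℝ :=
  2 * (f 0 z a * g 0 z b) + 2 * (f 1 z a * g 1 z b) - Fm wA f 0 z' * g 1 z b - Fm wA f 1 z' * g 0 z b
    - gm wB g 0 z' * f 1 z a - gm wB g 1 z' * f 0 z a - (Fm wA f 1 z' - Fm wA f 0 z') * (gm wB g 1 z' - gm wB g 0 z')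

end Kernel

section Law

variable {α β : Type} [Fintype α] [Fintype β]
  {wA : α → ℝ} {wB : β → ℝ} {wZ : Fin 2 → ℝ} {f : Fin 2 → Fin 2 → α → ℝ} {g : Fin 2 → Fin 2 → β → ℝ} {h : Fin 2 → α → β → ℝ}

/-- Fibre sum of `h·K(z;z')` at `(z,b)`. [this work] -/
theorem sum_a_levelKernel (z z' : Fin 2) (b : β) :
    (∑ a, wA a * (h z a b * levelKernel wA wB f g z z' a b)) =
      2 * (g 0 z b * Ysl wA f h 0 z b) + 2 * (g 1 z b * Ysl wA f h 1 z b)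
        - Fm wA f 0 z' * (g 1 z b * Hsl wA h z b) - Fm wA f 1 z' * (g 0 z b * Hsl wA h z b)
        - gm wB g 0 z' * Ysl wA f h 1 z b - gm wB g 1 z' * Ysl wA f h 0 z b
        - (Fm wA f 1 z' - Fm wA f 0 z') * (gm wB g 1 z' - gm wB g 0 z') * Hsl wA h z b := by
  have e : ∀ a, wA a * (h z a b * levelKernel wA wB f g z z' a b) =
      2 * (g 0 z b * (wA a * (f 0 z a * h z a b))) + 2 * (g 1 z b * (wA a * (f 1 z a * h z a b)))
        - Fm wA f 0 z' * (g 1 z b * (wA a * h z a b)) - Fm wA f 1 z' * (g 0 z b * (wA a * h z a b))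
        - gm wB g 0 z' * (wA a * (f 1 z a * h z a b)) - gm wB g 1 z' * (wA a * (f 0 z a * h z a b))
        - (Fm wA f 1 z' - Fm wA f 0 z') * (gm wB g 1 z' - gm wB g 0 z') * (wA a * h z a b) := fun a => by
    unfold levelKernel; ring
  simp only [e, sum_sub_distrib, sum_add_distrib, ← mul_sum]
  rfl

/-- **Kernel form of the level forms**: `levelForm z z' = Σ_b wB Σ_a wA h·K(z;z')`. [this work] -/
theorem levelForm_eq_kernel (z z' : Fin 2) :
    levelForm wA wB f g h z z' = ∑ b, wB b * ∑ a, wA a * (h z a b * levelKernel wA wB f g z z' a b) := by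
  have e : ∀ b, wB b * ∑ a, wA a * (h z a b * levelKernel wA wB f g z z' a b) =
      2 * (wB b * (g 0 z b * Ysl wA f h 0 z b)) + 2 * (wB b * (g 1 z b * Ysl wA f h 1 z b))
        - Fm wA f 0 z' * (wB b * (g 1 z b * Hsl wA h z b)) - Fm wA f 1 z' * (wB b * (g 0 z b * Hsl wA h z b))
        - gm wB g 0 z' * (wB b * Ysl wA f h 1 z b) - gm wB g 1 z' * (wB b * Ysl wA f h 0 z b)
        - (Fm wA f 1 z' - Fm wA f 0 z') * (gm wB g 1 z' - gm wB g 0 z') * (wB b * Hsl wA h z b) := fun b => by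
    rw [sum_a_levelKernel]; ring
  simp only [e, sum_sub_distrib, sum_add_distrib, ← mul_sum]
  rfl

/-- **THE EXPLICIT CERTIFICATE** for the one-level kernel (a polynomial identity in the section values and the four means). [this work] -/
theorem levelKernel_certificate (z : Fin 2) (a : α) (b : β) :
    Fm wA f 1 z * gm wB g 1 z * levelKernel wA wB f g z z a b =
      ((Fm wA f 1 z - Fm wA f 0 z) * (gm wB g 1 z - gm wB g 0 z) * gm wB g 1 z * (1 - g 1 z b)
          + (Fm wA f 0 z * (1 - (gm wB g 1 z - gm wB g 0 z)) + Fm wA f 1 z * (gm wB g 1 z - gm wB g 0 z)) * gm wB g 1 z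
              * (g 1 z b - g 0 z b)
          + (Fm wA f 0 z * (gm wB g 1 z - gm wB g 0 z) * (1 - gm wB g 1 z)
              + Fm wA f 1 z * gm wB g 1 z * (1 + (gm wB g 1 z - gm wB g 0 z))) * g 0 z b)
          * (f 1 z a - Fm wA f 1 z)
        + Fm wA f 1 z * gm wB g 0 z * g 0 z b * (f 0 z a - Fm wA f 0 z)
        + ((Fm wA f 1 z * gm wB g 1 z - Fm wA f 0 z * (gm wB g 1 z - gm wB g 0 z)) * (f 1 z a - f 0 z a)
            + (2 * Fm wA f 1 z - Fm wA f 0 z) * gm wB g 1 z * f 0 z a) * (g 1 z b - gm wB g 1 z)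
        + gm wB g 1 z * Fm wA f 0 z * f 0 z a * (g 0 z b - gm wB g 0 z)
        + ((Fm wA f 1 z * gm wB g 1 z - Fm wA f 0 z * gm wB g 0 z) * ((f 1 z a - f 0 z a) * (g 1 z b - g 0 z b))
            + (Fm wA f 1 z - Fm wA f 0 z) * (gm wB g 1 z - gm wB g 0 z) * (f 0 z a * g 0 z b)) := by
  unfold levelKernel; ring

/-- A level mean of a section with values in `[0,1]` lies in `[0,1]`. [this work] -/
theorem Fm_le_one (hA0 : ∀ a, 0 ≤ wA a) (hA1 : ∑ a, wA a = 1) (hf1 : ∀ i z a, f i z a ≤ 1) (i z : Fin 2) :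
    Fm wA f i z ≤ 1 := by
  unfold Fm
  calc (∑ a, wA a * f i z a) ≤ ∑ a, wA a := sum_le_sum fun a _ => by nlinarith [hA0 a, hf1 i z a]
    _ = 1 := hA1

/-- Level means are nonnegative. [this work] -/
theorem Fm_nonneg (hA0 : ∀ a, 0 ≤ wA a) (hf0 : ∀ i z a, 0 ≤ f i z a) (i z : Fin 2) : 0 ≤ Fm wA f i z :=
  sum_nonneg fun a _ => mul_nonneg (hA0 a) (hf0 i z a)

/-- Nested sections have nested means. [this work] -/
theorem Fm_mono_i (hA0 : ∀ a, 0 ≤ wA a) (hfi : ∀ z a, f 0 z a ≤ f 1 z a) (z : Fin 2) : Fm wA f 0 z ≤ Fm wA f 1 z :=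
  sum_le_sum fun a _ => mul_le_mul_of_nonneg_left (hfi z a) (hA0 a)

/-- (B-side) a level mean of a section with values in `[0,1]` lies in `[0,1]`. [this work] -/
theorem gm_le_one (hB0 : ∀ b, 0 ≤ wB b) (hB1 : ∑ b, wB b = 1) (hg1 : ∀ j z b, g j z b ≤ 1) (j z : Fin 2) :
    gm wB g j z ≤ 1 := by
  unfold gm
  calc (∑ b, wB b * g j z b) ≤ ∑ b, wB b := sum_le_sum fun b _ => by nlinarith [hB0 b, hg1 j z b]
    _ = 1 := hB1

/-- (B-side) level means are nonnegative. [this work] -/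
theorem gm_nonneg (hB0 : ∀ b, 0 ≤ wB b) (hg0 : ∀ j z b, 0 ≤ g j z b) (j z : Fin 2) : 0 ≤ gm wB g j z :=
  sum_nonneg fun b _ => mul_nonneg (hB0 b) (hg0 j z b)

/-- (B-side) nested sections have nested means. [this work] -/
theorem gm_mono_j (hB0 : ∀ b, 0 ≤ wB b) (hgj : ∀ z b, g 0 z b ≤ g 1 z b) (z : Fin 2) : gm wB g 0 z ≤ gm wB g 1 z :=
  sum_le_sum fun b _ => mul_le_mul_of_nonneg_left (hgj z b) (hB0 b)

omit [Fintype β] in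
/-- Pull a `b`-dependent factor out of a fibre sum. [folklore] -/
theorem sum_a_pull (z : Fin 2) (b : β) (c : ℝ) (X : α → ℝ) :
    (∑ a, wA a * (h z a b * (c * X a))) = c * ∑ a, wA a * (h z a b * X a) := by
  rw [mul_sum]; exact sum_congr rfl fun a _ => by ring

omit [Fintype α] in
/-- Pull an `a`-dependent factor out of a `b`-fibre sum. [folklore] -/
theorem sum_b_pull (z : Fin 2) (a : α) (c : ℝ) (X : β → ℝ) :
    (∑ b, wB b * (h z a b * (c * X b))) = c * ∑ b, wB b * (h z a b * X b) := by
  rw [mul_sum]; exact sum_congr rfl fun b _ => by ring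

/-- **THE CORE-REDUCED ONE-LEVEL LAW** (scaled by `A₁B₁`): the certificate still closes after REMOVING one unit of the `X¹`-Harris term on
the core column (`g₀·(f₁ − A₁)`) and one unit of the `Y¹`-Harris term on the core row (`f₀·(g₁ − B₁)`):
`Σ_b wB Σ_a wA h·(A₁B₁K₁ − A₁B₁g₀(f₁−A₁) − A₁B₁f₀(g₁−B₁)) ≥ 0`.  (The two removed multipliers of the certificate are `≥ A₁B₁`.)  This
strengthening is what the bias-free cross form of Theorem A needs (`…CrossFormThmA`). [this work] -/
theorem mul_levelKernel_coreReduced_nonneg [DistribLattice α] [DistribLattice β] (hA : IsFKGMeasure wA) (hB : IsFKGMeasure wB)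
    (hf0 : ∀ i z a, 0 ≤ f i z a) (hf1 : ∀ i z a, f i z a ≤ 1) (hfi : ∀ z a, f 0 z a ≤ f 1 z a) (hfa : ∀ i z, Monotone (f i z))
    (hg0 : ∀ j z b, 0 ≤ g j z b) (hg1 : ∀ j z b, g j z b ≤ 1) (hgj : ∀ z b, g 0 z b ≤ g 1 z b) (hgb : ∀ j z, Monotone (g j z))
    (hh0 : ∀ z a b, 0 ≤ h z a b) (hha : ∀ z b, Monotone (fun a => h z a b)) (hhb : ∀ z a, Monotone (h z a)) (z : Fin 2) :
    0 ≤ ∑ b, wB b * ∑ a, wA a * (h z a b * (Fm wA f 1 z * gm wB g 1 z * levelKernel wA wB f g z z a b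
        - Fm wA f 1 z * gm wB g 1 z * (g 0 z b * (f 1 z a - Fm wA f 1 z))
        - Fm wA f 1 z * gm wB g 1 z * (f 0 z a * (g 1 z b - gm wB g 1 z)))) := by
  have hA0 := hA.nonneg; have hB0 := hB.nonneg
  have a0 := Fm_nonneg hA0 hf0 0 z; have a01 := Fm_mono_i hA0 hfi z; have a1 := Fm_le_one hA0 hA.sum_eq_one hf1 1 z
  have b0 := gm_nonneg hB0 hg0 0 z; have b01 := gm_mono_j hB0 hgj z; have b1 := gm_le_one hB0 hB.sum_eq_one hg1 1 z
  set A0 := Fm wA f 0 z with hA0d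
  set A1 := Fm wA f 1 z with hA1d
  set B0 := gm wB g 0 z with hB0d
  set B1 := gm wB g 1 z with hB1d
  have hcert : ∀ a b, h z a b * (A1 * B1 * levelKernel wA wB f g z z a b - A1 * B1 * (g 0 z b * (f 1 z a - A1))
        - A1 * B1 * (f 0 z a * (g 1 z b - B1))) =
      h z a b * (((A1 - A0) * (B1 - B0) * B1 * (1 - g 1 z b) + (A0 * (1 - (B1 - B0)) + A1 * (B1 - B0)) * B1 * (g 1 z b - g 0 z b)
            + (A0 * (B1 - B0) * (1 - B1) + A1 * B1 * (B1 - B0)) * g 0 z b) * (f 1 z a - A1))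
        + (h z a b * ((A1 * B0 * g 0 z b) * (f 0 z a - A0))
        + (h z a b * (((A1 * B1 - A0 * (B1 - B0)) * (f 1 z a - f 0 z a) + (A1 - A0) * B1 * f 0 z a) * (g 1 z b - B1))
        + (h z a b * ((B1 * A0 * f 0 z a) * (g 0 z b - B0))
        + h z a b * ((A1 * B1 - A0 * B0) * ((f 1 z a - f 0 z a) * (g 1 z b - g 0 z b))
            + (A1 - A0) * (B1 - B0) * (f 0 z a * g 0 z b))))) := fun a b => by
    have := levelKernel_certificate (wA := wA) (wB := wB) (f := f) (g := g) z a b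
    rw [← hA0d, ← hA1d, ← hB0d, ← hB1d] at this
    calc h z a b * (A1 * B1 * levelKernel wA wB f g z z a b - A1 * B1 * (g 0 z b * (f 1 z a - A1))
          - A1 * B1 * (f 0 z a * (g 1 z b - B1)))
        = h z a b * (A1 * B1 * levelKernel wA wB f g z z a b) - h z a b * (A1 * B1 * (g 0 z b * (f 1 z a - A1)))
          - h z a b * (A1 * B1 * (f 0 z a * (g 1 z b - B1))) := by ring
      _ = _ := by rw [this]; ring
  simp only [hcert, sum2_add]
  -- term 1: fibre-Harris on α against f₁ with a nonnegative b-dependent multiplier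
  have t1 : 0 ≤ ∑ b, wB b * ∑ a, wA a * (h z a b *
      (((A1 - A0) * (B1 - B0) * B1 * (1 - g 1 z b) + (A0 * (1 - (B1 - B0)) + A1 * (B1 - B0)) * B1 * (g 1 z b - g 0 z b)
        + (A0 * (B1 - B0) * (1 - B1) + A1 * B1 * (B1 - B0)) * g 0 z b) * (f 1 z a - A1))) := by
    simp only [sum_a_pull]
    refine harrisA_nonneg hA hB0 hf0 hfa hh0 hha (fun b => ?_) z 1 z
    have g01 := hgj z b; have g1 := hg1 1 z b; have g00 := hg0 0 z b
    have c1 : 0 ≤ (A1 - A0) * (B1 - B0) * B1 :=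
      mul_nonneg (mul_nonneg (sub_nonneg.2 a01) (sub_nonneg.2 b01)) (le_trans b0 b01)
    have c2 : 0 ≤ (A0 * (1 - (B1 - B0)) + A1 * (B1 - B0)) * B1 := by
      have := mul_nonneg a0 (by linarith : (0:ℝ) ≤ 1 - (B1 - B0))
      have := mul_nonneg (le_trans a0 a01) (sub_nonneg.2 b01)
      exact mul_nonneg (by linarith) (le_trans b0 b01)
    have c3 : 0 ≤ A0 * (B1 - B0) * (1 - B1) + A1 * B1 * (B1 - B0) := by
      have := mul_nonneg (mul_nonneg a0 (sub_nonneg.2 b01)) (sub_nonneg.2 b1)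
      have := mul_nonneg (mul_nonneg (le_trans a0 a01) (le_trans b0 b01)) (sub_nonneg.2 b01)
      linarith
    nlinarith [mul_nonneg c1 (by linarith : (0:ℝ) ≤ 1 - g 1 z b), mul_nonneg c2 (by linarith : (0:ℝ) ≤ g 1 z b - g 0 z b),
      mul_nonneg c3 g00]
  -- term 2: fibre-Harris on α against f₀
  have t2 : 0 ≤ ∑ b, wB b * ∑ a, wA a * (h z a b * ((A1 * B0 * g 0 z b) * (f 0 z a - A0))) := by
    simp only [sum_a_pull]
    exact harrisA_nonneg hA hB0 hf0 hfa hh0 hha (fun b => mul_nonneg (mul_nonneg (le_trans a0 a01) b0) (hg0 0 z b)) z 0 z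
  -- term 3: fibre-Harris on β against g₁ with a nonnegative a-dependent multiplier
  have t3 : 0 ≤ ∑ b, wB b * ∑ a, wA a * (h z a b *
      ((((A1 * B1 - A0 * (B1 - B0)) * (f 1 z a - f 0 z a) + (A1 - A0) * B1 * f 0 z a)) * (g 1 z b - B1))) := by
    rw [sum_swap]; simp only [sum_b_pull]
    refine harrisB_nonneg hB hA0 hg0 hgb hh0 hhb (fun a => ?_) z 1 z
    have f01 := hfi z a; have f00 := hf0 0 z a
    have c1 : 0 ≤ A1 * B1 - A0 * (B1 - B0) := by
      have := mul_nonneg (sub_nonneg.2 a01) (le_trans b0 b01); have := mul_nonneg a0 b0; nlinarith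
    have c2 : 0 ≤ (A1 - A0) * B1 := mul_nonneg (by linarith) (by linarith)
    nlinarith [mul_nonneg c1 (by linarith : (0:ℝ) ≤ f 1 z a - f 0 z a), mul_nonneg c2 f00]
  -- term 4: fibre-Harris on β against g₀
  have t4 : 0 ≤ ∑ b, wB b * ∑ a, wA a * (h z a b * ((B1 * A0 * f 0 z a) * (g 0 z b - B0))) := by
    rw [sum_swap]; simp only [sum_b_pull]
    exact harrisB_nonneg hB hA0 hg0 hgb hh0 hhb (fun a => mul_nonneg (mul_nonneg (le_trans b0 b01) a0) (hf0 0 z a)) z 0 z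
  -- term 5: pointwise nonnegative residual
  have t5 : 0 ≤ ∑ b, wB b * ∑ a, wA a * (h z a b * ((A1 * B1 - A0 * B0) * ((f 1 z a - f 0 z a) * (g 1 z b - g 0 z b))
      + (A1 - A0) * (B1 - B0) * (f 0 z a * g 0 z b))) := by
    refine sum_nonneg fun b _ => mul_nonneg (hB0 b) (sum_nonneg fun a _ => mul_nonneg (hA0 a) (mul_nonneg (hh0 z a b) ?_))
    have f01 := hfi z a; have f00 := hf0 0 z a; have g01 := hgj z b; have g00 := hg0 0 z b
    have c1 : 0 ≤ A1 * B1 - A0 * B0 := by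
      have := mul_nonneg (sub_nonneg.2 a01) (le_trans b0 b01); have := mul_nonneg a0 (sub_nonneg.2 b01); nlinarith
    have c2 : 0 ≤ (A1 - A0) * (B1 - B0) := mul_nonneg (by linarith) (by linarith)
    have := mul_nonneg c1 (mul_nonneg (sub_nonneg.2 f01) (sub_nonneg.2 g01))
    have := mul_nonneg c2 (mul_nonneg f00 g00)
    linarith
  linarith

/-- **THE SCALED ONE-LEVEL LAW**: `A₁B₁·L ≥ 0`, by integrating the certificate against `h`. [this work] -/
theorem mul_levelForm_self_nonneg [DistribLattice α] [DistribLattice β] (hA : IsFKGMeasure wA) (hB : IsFKGMeasure wB)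
    (hf0 : ∀ i z a, 0 ≤ f i z a) (hf1 : ∀ i z a, f i z a ≤ 1) (hfi : ∀ z a, f 0 z a ≤ f 1 z a) (hfa : ∀ i z, Monotone (f i z))
    (hg0 : ∀ j z b, 0 ≤ g j z b) (hg1 : ∀ j z b, g j z b ≤ 1) (hgj : ∀ z b, g 0 z b ≤ g 1 z b) (hgb : ∀ j z, Monotone (g j z))
    (hh0 : ∀ z a b, 0 ≤ h z a b) (hha : ∀ z b, Monotone (fun a => h z a b)) (hhb : ∀ z a, Monotone (h z a)) (z : Fin 2) :
    0 ≤ Fm wA f 1 z * gm wB g 1 z * levelForm wA wB f g h z z := by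
  have hA0 := hA.nonneg; have hB0 := hB.nonneg
  have hAB : 0 ≤ Fm wA f 1 z * gm wB g 1 z := mul_nonneg (Fm_nonneg hA0 hf0 1 z) (gm_nonneg hB0 hg0 1 z)
  rw [levelForm_eq_kernel, ← sum2_smul]
  have e : ∀ a b, Fm wA f 1 z * gm wB g 1 z * (h z a b * levelKernel wA wB f g z z a b) =
      h z a b * (Fm wA f 1 z * gm wB g 1 z * levelKernel wA wB f g z z a b
        - Fm wA f 1 z * gm wB g 1 z * (g 0 z b * (f 1 z a - Fm wA f 1 z))
        - Fm wA f 1 z * gm wB g 1 z * (f 0 z a * (g 1 z b - gm wB g 1 z)))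
      + (h z a b * ((Fm wA f 1 z * gm wB g 1 z * g 0 z b) * (f 1 z a - Fm wA f 1 z))
      + h z a b * ((Fm wA f 1 z * gm wB g 1 z * f 0 z a) * (g 1 z b - gm wB g 1 z))) := fun a b => by ring
  simp only [e, sum2_add]
  have t0 := mul_levelKernel_coreReduced_nonneg hA hB hf0 hf1 hfi hfa hg0 hg1 hgj hgb hh0 hha hhb z
  have t1 : 0 ≤ ∑ b, wB b * ∑ a, wA a * (h z a b * ((Fm wA f 1 z * gm wB g 1 z * g 0 z b) * (f 1 z a - Fm wA f 1 z))) := by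
    simp only [sum_a_pull]
    exact harrisA_nonneg hA hB0 hf0 hfa hh0 hha (fun b => mul_nonneg hAB (hg0 0 z b)) z 1 z
  have t2 : 0 ≤ ∑ b, wB b * ∑ a, wA a * (h z a b * ((Fm wA f 1 z * gm wB g 1 z * f 0 z a) * (g 1 z b - gm wB g 1 z))) := by
    rw [sum_swap]; simp only [sum_b_pull]
    exact harrisB_nonneg hB hA0 hg0 hgb hh0 hhb (fun a => mul_nonneg hAB (hf0 0 z a)) z 1 z
  linarith

/-- A section of mean zero contributes nothing: `Σ_a wA a f a = 0` with nonnegative terms forces `wA a · f a = 0` for all `a`. [this work] -/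
theorem mul_eq_zero_of_Fm_eq_zero (hA0 : ∀ a, 0 ≤ wA a) (hf0 : ∀ i z a, 0 ≤ f i z a) {i z : Fin 2} (hz : Fm wA f i z = 0) (a : α) :
    wA a * f i z a = 0 :=
  (sum_eq_zero_iff_of_nonneg fun a _ => mul_nonneg (hA0 a) (hf0 i z a)).1 hz a (mem_univ a)

/-- Degenerate level on the `α` side: if `A₁ = 0` then the one-level form vanishes. [this work] -/
theorem levelForm_self_eq_zero_of_Fm (hA0 : ∀ a, 0 ≤ wA a) (hf0 : ∀ i z a, 0 ≤ f i z a) (hfi : ∀ z a, f 0 z a ≤ f 1 z a)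
    {z : Fin 2} (hz : Fm wA f 1 z = 0) : levelForm wA wB f g h z z = 0 := by
  have h1 : ∀ a, wA a * f 1 z a = 0 := mul_eq_zero_of_Fm_eq_zero hA0 hf0 hz
  have hz0 : Fm wA f 0 z = 0 :=
    le_antisymm (le_trans (Fm_mono_i hA0 hfi z) (le_of_eq hz)) (Fm_nonneg hA0 hf0 0 z)
  have h0 : ∀ a, wA a * f 0 z a = 0 := mul_eq_zero_of_Fm_eq_zero hA0 hf0 hz0
  have hY : ∀ i b, Ysl wA f h i z b = 0 := fun i b => by
    unfold Ysl
    refine sum_eq_zero fun a _ => ?_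
    have : wA a * f i z a = 0 := by fin_cases i; exacts [h0 a, h1 a]
    calc wA a * (f i z a * h z a b) = (wA a * f i z a) * h z a b := by ring
      _ = 0 := by rw [this, zero_mul]
  have hS : ∀ i j, Sgy wA wB f g h i j z = 0 := fun i j => by
    unfold Sgy; exact sum_eq_zero fun b _ => by rw [hY]; ring
  have hYb : ∀ i, Ybar wA wB f h i z = 0 := fun i => by
    unfold Ybar; exact sum_eq_zero fun b _ => by rw [hY]; ring
  unfold levelForm
  rw [hS, hS, hYb, hYb, hz, hz0]
  ring

/-- Degenerate level on the `β` side: if `B₁ = 0` then the one-level form vanishes. [this work] -/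
theorem levelForm_self_eq_zero_of_gm (hB0 : ∀ b, 0 ≤ wB b) (hg0 : ∀ j z b, 0 ≤ g j z b) (hgj : ∀ z b, g 0 z b ≤ g 1 z b)
    {z : Fin 2} (hz : gm wB g 1 z = 0) : levelForm wA wB f g h z z = 0 := by
  have h1 : ∀ b, wB b * g 1 z b = 0 :=
    (sum_eq_zero_iff_of_nonneg fun b _ => mul_nonneg (hB0 b) (hg0 1 z b)).1 hz
      |> fun H b => H b (mem_univ b)
  have hz0 : gm wB g 0 z = 0 :=
    le_antisymm (le_trans (gm_mono_j hB0 hgj z) (le_of_eq hz)) (gm_nonneg hB0 hg0 0 z)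
  have h0 : ∀ b, wB b * g 0 z b = 0 :=
    (sum_eq_zero_iff_of_nonneg fun b _ => mul_nonneg (hB0 b) (hg0 0 z b)).1 hz0
      |> fun H b => H b (mem_univ b)
  have hS : ∀ i j, Sgy wA wB f g h i j z = 0 := fun i j => by
    unfold Sgy
    refine sum_eq_zero fun b _ => ?_
    have : wB b * g j z b = 0 := by fin_cases j; exacts [h0 b, h1 b]
    calc wB b * (g j z b * Ysl wA f h i z b) = (wB b * g j z b) * Ysl wA f h i z b := by ring
      _ = 0 := by rw [this, zero_mul]
  have hG : ∀ j, Sgh wA wB g h j z = 0 := fun j => by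
    unfold Sgh
    refine sum_eq_zero fun b _ => ?_
    have : wB b * g j z b = 0 := by fin_cases j; exacts [h0 b, h1 b]
    calc wB b * (g j z b * Hsl wA h z b) = (wB b * g j z b) * Hsl wA h z b := by ring
      _ = 0 := by rw [this, zero_mul]
  unfold levelForm
  rw [hS, hS, hG, hG, hz, hz0]
  ring

/-- **THE ONE-LEVEL ("INDEPENDENT TOPS") LAW ON ABSTRACT FKG BLOCKS**: `levelForm z z ≥ 0` — for nested `[0,1]`-valued monotone sections
`f 0 z ≤ f 1 z` on `α`, `g 0 z ≤ g 1 z` on `β`, and any nonnegative `h z` monotone in each argument, under FKG probability weights. [this work] -/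
theorem levelForm_self_nonneg [DistribLattice α] [DistribLattice β] (hA : IsFKGMeasure wA) (hB : IsFKGMeasure wB)
    (hf0 : ∀ i z a, 0 ≤ f i z a) (hf1 : ∀ i z a, f i z a ≤ 1) (hfi : ∀ z a, f 0 z a ≤ f 1 z a) (hfa : ∀ i z, Monotone (f i z))
    (hg0 : ∀ j z b, 0 ≤ g j z b) (hg1 : ∀ j z b, g j z b ≤ 1) (hgj : ∀ z b, g 0 z b ≤ g 1 z b) (hgb : ∀ j z, Monotone (g j z))
    (hh0 : ∀ z a b, 0 ≤ h z a b) (hha : ∀ z b, Monotone (fun a => h z a b)) (hhb : ∀ z a, Monotone (h z a)) (z : Fin 2) :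
    0 ≤ levelForm wA wB f g h z z := by
  have hmain := mul_levelForm_self_nonneg hA hB hf0 hf1 hfi hfa hg0 hg1 hgj hgb hh0 hha hhb z
  by_cases hz : Fm wA f 1 z = 0
  · exact le_of_eq (levelForm_self_eq_zero_of_Fm (g := g) (h := h) (wB := wB) hA.nonneg hf0 hfi hz).symm
  by_cases hz' : gm wB g 1 z = 0
  · exact le_of_eq (levelForm_self_eq_zero_of_gm (f := f) (h := h) (wA := wA) hB.nonneg hg0 hgj hz').symm
  have hp : 0 < Fm wA f 1 z := lt_of_le_of_ne (Fm_nonneg hA.nonneg hf0 1 z) (Ne.symm hz)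
  have hq : 0 < gm wB g 1 z := lt_of_le_of_ne (gm_nonneg hB.nonneg hg0 1 z) (Ne.symm hz')
  have hpq : 0 < Fm wA f 1 z * gm wB g 1 z := mul_pos hp hq
  by_contra hneg
  have := mul_neg_of_pos_of_neg hpq (not_le.mp hneg)
  linarith

/-- **REDUCTION OF T₁(|C|=1) TO THE BIAS-FREE INEQUALITY ALONE.**  For nested `[0,1]`-valued sections increasing in the hub level and
FKG blocks, `crossForm ≥ 0` implies `twoLevel ≥ 0` at every hub bias (the one-level hypotheses of `twoLevel_nonneg_of_crossForm_nonneg` are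
discharged by `levelForm_self_nonneg`).  Then `sahiE_three_nonneg_T1C1_of_twoLevel_nonneg` gives Kahn's `C₃` on the T₁(|C|=1) triple. [this work] -/
theorem twoLevel_nonneg_of_crossForm_nonneg' [DistribLattice α] [DistribLattice β] (hA : IsFKGMeasure wA) (hB : IsFKGMeasure wB)
    (hZ0 : 0 ≤ wZ 0) (hZ1 : 0 ≤ wZ 1) (hZ : wZ 0 + wZ 1 = 1)
    (hf0 : ∀ i z a, 0 ≤ f i z a) (hf1 : ∀ i z a, f i z a ≤ 1) (hfi : ∀ z a, f 0 z a ≤ f 1 z a) (hfa : ∀ i z, Monotone (f i z))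
    (hfz : ∀ i a, f i 0 a ≤ f i 1 a)
    (hg0 : ∀ j z b, 0 ≤ g j z b) (hg1 : ∀ j z b, g j z b ≤ 1) (hgj : ∀ z b, g 0 z b ≤ g 1 z b) (hgb : ∀ j z, Monotone (g j z))
    (hgz : ∀ j b, g j 0 b ≤ g j 1 b)
    (hh0 : ∀ z a b, 0 ≤ h z a b) (hha : ∀ z b, Monotone (fun a => h z a b)) (hhb : ∀ z a, Monotone (h z a))
    (hhz : ∀ a b, h 0 a b ≤ h 1 a b) (hX : 0 ≤ crossForm wA wB f g h) :
    0 ≤ twoLevel wA wB wZ f g h :=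
  twoLevel_nonneg_of_crossForm_nonneg hZ0 hZ1 hZ hA.nonneg hB.nonneg hfz hgz hhz
    (levelForm_self_nonneg hA hB hf0 hf1 hfi hfa hg0 hg1 hgj hgb hh0 hha hhb 0)
    (levelForm_self_nonneg hA hB hf0 hf1 hfi hfa hg0 hg1 hgj hgb hh0 hha hhb 1) hX

end Law

end SahiHubTwoLevel

end Summit.CriticalPhenomena.PercolationContinuityZ3.Theorems
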